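import Summits.ValiantsHypothesis.ValiantsHypothesis.Theorems.Depth4HomFourRung
import HarnessLib

/-!
# Depth4 — rung 1¼ in the door's own currency: a UNIFORM quasi-polynomial lower bound
# `(n+2)^{(log(n+2))^δ} < homDepthFourCircuitSize per_n` i.o. (support for crux `Depth4HomFour` =
# item `stmt-ValiantsHypothesis-11333`; lens 4, g30)

Rung one on the door (`Depth4HomFourRung.homDepthFour_perPoly_io`, g28) gives every FIXED exponent,
`n` chosen after it.  Here ★ `homDepthFour_perPoly_io_quasi`: `∃ δ > 0, ∀ m₀, ∃ n ≥ m₀, ∀ s,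
homDepthFourCircuitSize per_n ≤ s → (n+2)^{(log(n+2))^δ} < s` — `δ` BEFORE `n`.  Rung one does
NOT imply it (a measure `n^{a(n)}`, `a(n) → ∞` arbitrarily slowly, satisfies rung one and violates
every `(log n)^δ`).  Mechanism, maths KNOWN: Limaye–Srinivasan–Tavenas (PROVED in the tree:
`lst_constantDepth_imm_lower_bound_holds`) at the top of its degree range `d = ⌊ε log m⌋`; Valiant
completeness transports uniformly small constant-depth circuits for all `per_n` to
`IMM_{m,⌊ε log m⌋}` (`exists_imm_circuits_of_per_circuits` = the transport block of
`DepthWindow.perHardConstDepth` over a monotone size function — valid since constant product-depth,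
unlike homogeneous `ΣΠΣΠ`, is closed under substituting constants); `quasi_arith` closes the
window; small `n` are absorbed into the constant (`DefinabilityGapK1ConstDepthRung.perHard_io`
pattern); the g28 rebuild `Depth4HomFourRung.exists_productDepth_two_of_homDepthFour` (KS §3
normal form) moves the bound to the door, halving `δ`.  HONESTY: rung 1¼ on the door measure;
maths KNOWN (LST Cor. 4 at `d = ε log m` + Valiant transport + KS §3); VP-saturated (`IMM`, `det`
obey the same floor by the same citation — separates nothing); 0 S-currency; not slope `√n`; crux
11333, the fixed-slope window and `VP ≠ VNP` untouched; in class it matches the cap `LSTTransportCap`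
(the LST ladder on the door lives inside `n^{(log n)^{Θ(1)}}`).  Real helpers: `phi_mono`, `quasi_core`.
-/

set_option linter.dupNamespace false

noncomputable section

open MvPolynomial Literature.Computability.AlgebraicComplexity ArithCircuit
open Literature.Computability.Complexity
open Summit.ValiantsHypothesis.ValiantsHypothesis.Theorems

namespace Summit.ValiantsHypothesis.ValiantsHypothesis.Theorems.Depth4HomFourQuasi

/-- **Transport** (Valiant completeness, ℕ-only; pattern of `DepthWindow.perHardConstDepth`,
factored over a monotone size function `S`): uniformly small constant-depth circuits for every
`per_n` give constant-depth circuits for `IMM_{m, dd m}` of size `≤ S (m^b + b)`.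
[cite: Valiant1979] -/
theorem exists_imm_circuits_of_per_circuits {Δ : ℕ} (dd : ℕ → ℕ) (hdd : ∀ m, dd m ≤ m)
    (S : ℕ → ℕ) (hS : Monotone S)
    (h : ∀ n : ℕ, ∃ C : ArithCircuit ℂ (Fin n × Fin n),
      C.Computes (perPoly (Fin n) ℂ) ∧ C.productDepth ≤ Δ ∧ C.edgeSize ≤ S n) :
    ∃ b : ℕ, ∀ m : ℕ, ∃ D : ArithCircuit ℂ (Fin (dd m) × Fin m × Fin m),
      D.Computes (immPoly m (dd m) ℂ) ∧ D.productDepth ≤ Δ ∧ D.size ≤ S (m ^ b + b) := by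
  classical
  let v : ℕ → ℕ := fun m => Fintype.card (Fin (dd m) × Fin m × Fin m)
  let e : ∀ m, (Fin (dd m) × Fin m × Fin m) ≃ Fin (v m) := fun m => Fintype.equivFin _
  let G : ∀ m, MvPolynomial (Fin (dd m) × Fin m × Fin m) ℂ := fun m => immPoly m (dd m) ℂ
  let G' : ∀ m, MvPolynomial (Fin (v m)) ℂ := fun m => renameEquiv ℂ (e m) (G m)
  have hG : IsVPFamily G := by
    refine ⟨⟨⟨3, fun m => ?_⟩, ⟨1, fun m => ?_⟩⟩, ⟨6, fun m => ?_⟩⟩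
    · show Fintype.card (Fin (dd m) × Fin m × Fin m) ≤ m ^ 3 + 3
      simp only [Fintype.card_prod, Fintype.card_fin]
      calc dd m * (m * m) ≤ m * (m * m) := Nat.mul_le_mul_right _ (hdd m)
        _ ≤ m ^ 3 + 3 := by ring_nf; omega
    · show (immPoly m (dd m) ℂ).totalDegree ≤ m ^ 1 + 1
      refine ((immPoly_isHomogeneous_holds (k := ℂ) m (dd m)).totalDegree_le).trans ?_
      rw [pow_one]; exact (hdd m).trans (Nat.le_succ m)
    · show complexity (immPoly m (dd m) ℂ) ≤ m ^ 6 + 6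
      calc complexity (immPoly m (dd m) ℂ) ≤ m + 2 * m ^ 3 * dd m :=
            complexity_immPoly_le ℂ m (dd m)
        _ ≤ m ^ 1 + 2 * (m ^ 1) ^ 3 * m := by
            rw [pow_one]; exact Nat.add_le_add_left (Nat.mul_le_mul_left _ (hdd m)) _
        _ ≤ m ^ (3 * 1 + 3) + (3 * 1 + 3) := imm_cost_le 1 m
        _ = m ^ 6 + 6 := by norm_num
  obtain ⟨t, ⟨b, hb⟩, hproj⟩ := (isVNPComplete_perPoly_holds ℂ ringChar_complex_ne_two).2 v G'
    (IsVPFamily.isVNPFamily_holds' ((isVPFamily_renameEquiv_iff e G).2 hG))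
  refine ⟨b, fun m => ?_⟩
  obtain ⟨C, hCc, hCd, hCe⟩ := h (t m)
  obtain ⟨D', hD'c, hD'd, hD'e, -⟩ := DepthWindow.exists_circuit_of_isProjection (hproj m) C hCc
  have hGm : MvPolynomial.rename (e m).symm (G' m) = immPoly m (dd m) ℂ := by
    show MvPolynomial.rename (e m).symm (renameEquiv ℂ (e m) (G m)) = G m
    rw [renameEquiv_apply, rename_rename, (e m).symm_comp_self, rename_id_apply]
  obtain ⟨D, hDe, hDd, hDw, hDs⟩ := exists_size_le_edgeSize (D'.rename (e m).symm)
  refine ⟨D, ?_, hDd.trans ((DepthThreeChasm.productDepth_rename _ _).le.trans (hD'd.trans hCd)),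
    ?_⟩
  · rw [Computes, hDe, ← hGm]; exact hD'c.rename (e m).symm
  · calc D.size ≤ D.edgeSize := hDs
      _ ≤ (D'.rename (e m).symm).edgeSize := hDw
      _ = D'.edgeSize := DepthThreeChasm.edgeSize_rename _ _
      _ ≤ C.edgeSize := hD'e
      _ ≤ S (t m) := hCe
      _ ≤ S (m ^ b + b) := hS (hb m)

/-- Real helper 1: `Φ_δ(n) = (n+2)^{(log(n+2))^δ}` is monotone in `n` (`δ ≥ 0`). [folklore] -/
theorem phi_mono {δ : ℝ} (hδ : 0 ≤ δ) {n n' : ℕ} (h : n ≤ n') :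
    ((n : ℝ) + 2) ^ (Real.log ((n : ℝ) + 2)) ^ δ ≤
      ((n' : ℝ) + 2) ^ (Real.log ((n' : ℝ) + 2)) ^ δ := by
  have hn : (0 : ℝ) ≤ n := Nat.cast_nonneg n
  have hnn' : (n : ℝ) ≤ n' := Nat.cast_le.2 h
  have hlog : 0 ≤ Real.log ((n : ℝ) + 2) := Real.log_nonneg (by linarith)
  have hlog' : Real.log ((n : ℝ) + 2) ≤ Real.log ((n' : ℝ) + 2) :=
    Real.log_le_log (by linarith) (by linarith)
  exact (Real.rpow_le_rpow (by linarith) (by linarith) (Real.rpow_nonneg hlog δ)).trans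
    (Real.rpow_le_rpow_of_exponent_le (by linarith) (Real.rpow_le_rpow hlog hlog' hδ))

/-- Real-arithmetic helper 2 (core of the window): for `δ, ε > 0`, `c ≥ 1` and all large real
`x`, `K + (c x)^{δ/2}·(c x) < (ε x / 2)^δ · x`. [folklore] -/
theorem quasi_core (K : ℕ) {δ ε c : ℝ} (hδ : 0 < δ) (hε : 0 < ε) (hc : 1 ≤ c) :
    ∃ X : ℝ, 0 ≤ X ∧ ∀ x : ℝ, X ≤ x →
      (K : ℝ) + (c * x) ^ (δ / 2) * (c * x) < (ε * x / 2) ^ δ * x := by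
  have he : 0 < (ε / 2) ^ δ := Real.rpow_pos_of_pos (by positivity) δ
  have hδ2 : 0 < δ / 2 := by positivity
  have hc0 : 0 < c := by linarith
  obtain ⟨C₁, hC₁0, hC₁⟩ : ∃ C₁ : ℝ, 0 ≤ C₁ ∧ C₁ = 2 * (c ^ (δ / 2) * c) / (ε / 2) ^ δ :=
    ⟨_, by positivity, rfl⟩
  refine ⟨K + 1 + (⌈C₁ ^ (1 / (δ / 2))⌉₊ + 1 : ℕ), by positivity, fun x hx => ?_⟩
  have hN₁0 : (0 : ℝ) ≤ ((⌈C₁ ^ (1 / (δ / 2))⌉₊ + 1 : ℕ) : ℝ) := Nat.cast_nonneg _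
  have hK0 : (0 : ℝ) ≤ K := Nat.cast_nonneg K
  have hx0 : 0 < x := by linarith
  have hp : C₁ ≤ x ^ (δ / 2) :=
    (LSTWord.le_rpow_of_ceil_le hC₁0 hδ2 (Nat.le_floor (by linarith))).trans
      (Real.rpow_le_rpow (Nat.cast_nonneg _) (Nat.floor_le hx0.le) hδ2.le)
  have hsplit : x ^ δ = x ^ (δ / 2) * x ^ (δ / 2) := by rw [← Real.rpow_add hx0]; ring_nf
  have hmul1 : (c * x) ^ (δ / 2) = c ^ (δ / 2) * x ^ (δ / 2) := Real.mul_rpow hc0.le hx0.le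
  have hmul2 : (ε * x / 2) ^ δ = (ε / 2) ^ δ * x ^ δ := by
    rw [show ε * x / 2 = (ε / 2) * x by ring]; exact Real.mul_rpow (by positivity) hx0.le
  have hT2 : x ≤ (c * x) ^ (δ / 2) * (c * x) :=
    calc x ≤ c * x := le_mul_of_one_le_left hx0.le hc
      _ = 1 * (c * x) := (one_mul _).symm
      _ ≤ (c * x) ^ (δ / 2) * (c * x) := mul_le_mul_of_nonneg_right
          (Real.one_le_rpow (one_le_mul_of_one_le_of_one_le hc (by linarith)) hδ2.le)
          (by positivity)
  have hT : 2 * ((c * x) ^ (δ / 2) * (c * x)) ≤ (ε * x / 2) ^ δ * x := by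
    have h1 : 2 * (c ^ (δ / 2) * c) ≤ (ε / 2) ^ δ * x ^ (δ / 2) := by
      have h2 : 2 * (c ^ (δ / 2) * c) / (ε / 2) ^ δ ≤ x ^ (δ / 2) := hC₁ ▸ hp
      rw [div_le_iff₀ he] at h2
      linarith
    rw [hmul1, hmul2, hsplit]
    have hpx : 0 ≤ x ^ (δ / 2) * x := by positivity
    calc 2 * (c ^ (δ / 2) * x ^ (δ / 2) * (c * x))
        = (2 * (c ^ (δ / 2) * c)) * (x ^ (δ / 2) * x) := by ring
      _ ≤ ((ε / 2) ^ δ * x ^ (δ / 2)) * (x ^ (δ / 2) * x) := mul_le_mul_of_nonneg_right h1 hpx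
      _ = (ε / 2) ^ δ * (x ^ (δ / 2) * x ^ (δ / 2)) * x := by ring
  linarith [hT2, hT]

/-- **Arithmetic of the quasi-polynomial window**: for `0 < δ ≤ 1`, `0 < ε ≤ 1` and all `b, K, d₀,
M₀` there is `m ≥ M₀` with `d₀ ≤ ⌊ε log m⌋ ≤ m` and
`K · (m^b+b+2)^{(log(m^b+b+2))^{δ/2}} < m^{⌊ε log m⌋^δ}`. [folklore] -/
theorem quasi_arith (b K d₀ M₀ : ℕ) {δ ε : ℝ} (hδ : 0 < δ) (hδ1 : δ ≤ 1) (hε : 0 < ε)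
    (hε1 : ε ≤ 1) :
    ∃ m : ℕ, M₀ ≤ m ∧ 2 ≤ m ∧ d₀ ≤ ⌊ε * Real.log m⌋₊ ∧ ⌊ε * Real.log m⌋₊ ≤ m ∧
      (K : ℝ) * ((((m ^ b + b : ℕ) : ℝ) + 2) ^ (Real.log (((m ^ b + b : ℕ) : ℝ) + 2)) ^ (δ / 2)) <
        (m : ℝ) ^ (((⌊ε * Real.log m⌋₊ : ℕ) : ℝ) ^ δ) := by
  have _h := hδ1
  obtain ⟨X, hX0, hX⟩ := quasi_core K (c := (b : ℝ) + 2) hδ hε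
    (by linarith [(Nat.cast_nonneg b : (0 : ℝ) ≤ b)])
  obtain ⟨m, hmM, hm2, hmexp⟩ : ∃ m : ℕ, M₀ ≤ m ∧ 2 ≤ m ∧
      ⌈Real.exp (X + ((d₀ : ℝ) + 2) / ε)⌉₊ ≤ m :=
    ⟨max (max M₀ 2) ⌈Real.exp (X + ((d₀ : ℝ) + 2) / ε)⌉₊, (le_max_left _ _).trans (le_max_left _ _),
      (le_max_right _ _).trans (le_max_left _ _), le_max_right _ _⟩
  have hm0 : (0 : ℝ) < m := by exact_mod_cast (show 0 < m by omega)
  have hY : X + ((d₀ : ℝ) + 2) / ε ≤ Real.log m := by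
    rw [Real.le_log_iff_exp_le hm0]
    exact (Nat.le_ceil _).trans (by exact_mod_cast hmexp)
  have hd₀ε0 : 0 ≤ ((d₀ : ℝ) + 2) / ε := by positivity
  have hεx : (d₀ : ℝ) + 2 ≤ ε * Real.log m := by
    have h1 : ((d₀ : ℝ) + 2) / ε ≤ Real.log m := by linarith
    rw [div_le_iff₀ hε] at h1
    linarith
  have hx0 : 0 ≤ Real.log m := Real.log_natCast_nonneg m
  have hεx0 : 0 ≤ ε * Real.log m := mul_nonneg hε.le hx0
  have hDm : ⌊ε * Real.log m⌋₊ ≤ m := by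
    have h1 : (⌊ε * Real.log m⌋₊ : ℝ) ≤ ε * Real.log m := Nat.floor_le hεx0
    have h2 : ε * Real.log m ≤ Real.log m := by nlinarith
    have h3 : Real.log m ≤ (m : ℝ) := by linarith [Real.log_le_sub_one_of_pos hm0]
    exact_mod_cast h1.trans (h2.trans h3)
  have hDge : ε * Real.log m / 2 ≤ (⌊ε * Real.log m⌋₊ : ℝ) := by
    linarith [Nat.lt_floor_add_one (ε * Real.log m)]
  refine ⟨m, hmM, hm2, Nat.le_floor (by linarith), hDm, ?_⟩
  have hnat : m ^ b + b + 2 ≤ m ^ (b + 2) := by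
    have h2b : b < 2 ^ b := Nat.lt_two_pow_self
    have hpow : 2 ^ b ≤ m ^ b := Nat.pow_le_pow_left hm2 b
    have hmm : 4 ≤ m * m := by nlinarith
    calc m ^ b + b + 2 ≤ 4 * m ^ b := by omega
      _ ≤ m * m * m ^ b := Nat.mul_le_mul_right _ hmm
      _ = m ^ (b + 2) := by ring
  have hA0 : (0 : ℝ) < ((m ^ b + b : ℕ) : ℝ) + 2 := by positivity
  have hA1 : (1 : ℝ) ≤ ((m ^ b + b : ℕ) : ℝ) + 2 := by
    linarith [(Nat.cast_nonneg (m ^ b + b) : (0 : ℝ) ≤ ((m ^ b + b : ℕ) : ℝ))]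
  have hA : Real.log (((m ^ b + b : ℕ) : ℝ) + 2) ≤ ((b : ℝ) + 2) * Real.log m := by
    have hle : ((m ^ b + b : ℕ) : ℝ) + 2 ≤ (m : ℝ) ^ (b + 2) := by
      have h1 : ((m ^ b + b + 2 : ℕ) : ℝ) ≤ ((m ^ (b + 2) : ℕ) : ℝ) := by exact_mod_cast hnat
      push_cast at h1 ⊢
      linarith
    calc Real.log (((m ^ b + b : ℕ) : ℝ) + 2) ≤ Real.log ((m : ℝ) ^ (b + 2)) :=
          Real.log_le_log hA0 hle
      _ = ((b + 2 : ℕ) : ℝ) * Real.log m := Real.log_pow _ _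
      _ = ((b : ℝ) + 2) * Real.log m := by push_cast; ring
  have hL0 : 0 ≤ Real.log (((m ^ b + b : ℕ) : ℝ) + 2) := Real.log_nonneg hA1
  have hc0 : 0 ≤ ((b : ℝ) + 2) * Real.log m := mul_nonneg (by positivity) hx0
  have hΦpos : 0 < (((m ^ b + b : ℕ) : ℝ) + 2) ^ (Real.log (((m ^ b + b : ℕ) : ℝ) + 2)) ^ (δ / 2) :=
    Real.rpow_pos_of_pos hA0 _
  have hlogΦ : Real.log ((((m ^ b + b : ℕ) : ℝ) + 2) ^
      (Real.log (((m ^ b + b : ℕ) : ℝ) + 2)) ^ (δ / 2)) ≤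
        (((b : ℝ) + 2) * Real.log m) ^ (δ / 2) * (((b : ℝ) + 2) * Real.log m) := by
    rw [Real.log_rpow hA0]
    exact mul_le_mul (Real.rpow_le_rpow hL0 hA (by positivity)) hA hL0 (Real.rpow_nonneg hc0 _)
  have hK1 : (0 : ℝ) < (K : ℝ) + 1 := by positivity
  have hlogK : Real.log ((K : ℝ) + 1) ≤ K := by linarith [Real.log_le_sub_one_of_pos hK1]
  have hRle : (ε * Real.log m / 2) ^ δ * Real.log m ≤
      (((⌊ε * Real.log m⌋₊ : ℕ) : ℝ) ^ δ) * Real.log m :=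
    mul_le_mul_of_nonneg_right (Real.rpow_le_rpow (by linarith) hDge hδ.le) hx0
  have hfin : ((K : ℝ) + 1) * (((m ^ b + b : ℕ) : ℝ) + 2) ^
      (Real.log (((m ^ b + b : ℕ) : ℝ) + 2)) ^ (δ / 2) <
        (m : ℝ) ^ (((⌊ε * Real.log m⌋₊ : ℕ) : ℝ) ^ δ) := by
    rw [Real.lt_rpow_iff_log_lt (by positivity) hm0, Real.log_mul hK1.ne' hΦpos.ne']
    linarith [hX (Real.log m) (by linarith), hlogΦ, hlogK, hRle]
  exact (mul_le_mul_of_nonneg_right (by linarith) hΦpos.le).trans_lt hfin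

/-- **`per` is quasi-polynomially hard at every constant product-depth** (uniform form): for every
`Δ₀` some `δ > 0` admits no constant `K` with product-depth-`≤ Δ₀` circuits for all `per_n` of
`≤ K · (n+2)^{(log(n+2))^δ}` wires. [cite: LimayeSrinivasanTavenas2025, Cor. 4]
[cite: Valiant1979] -/
theorem perHardQuasi (Δ₀ : ℕ) :
    ∃ δ : ℝ, 0 < δ ∧ ¬ ∃ K : ℕ, ∀ n : ℕ, ∃ C : ArithCircuit ℂ (Fin n × Fin n),
      C.Computes (perPoly (Fin n) ℂ) ∧ C.productDepth ≤ Δ₀ ∧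
        (C.edgeSize : ℝ) ≤ K * (((n : ℝ) + 2) ^ (Real.log ((n : ℝ) + 2)) ^ δ) := by
  classical
  obtain ⟨δL, hδL, ε, hε, d₀, hL⟩ :=
    lst_constantDepth_imm_lower_bound_holds ℂ (max Δ₀ 1) (le_max_right _ _)
  obtain ⟨δ₁, hδ₁, hδ₁1, hδ₁le⟩ : ∃ δ₁ : ℝ, 0 < δ₁ ∧ δ₁ ≤ 1 ∧ δ₁ ≤ δL :=
    ⟨min δL 1, lt_min hδL one_pos, min_le_right _ _, min_le_left _ _⟩
  obtain ⟨ε₁, hε₁, hε₁1, hε₁le⟩ : ∃ ε₁ : ℝ, 0 < ε₁ ∧ ε₁ ≤ 1 ∧ ε₁ ≤ ε :=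
    ⟨min ε 1, lt_min hε one_pos, min_le_right _ _, min_le_left _ _⟩
  refine ⟨δ₁ / 2, by positivity, ?_⟩
  rintro ⟨K, hK⟩
  let dd : ℕ → ℕ := fun m => min m ⌊ε₁ * Real.log m⌋₊
  let S : ℕ → ℕ := fun n => ⌊(K : ℝ) * (((n : ℝ) + 2) ^ (Real.log ((n : ℝ) + 2)) ^ (δ₁ / 2))⌋₊
  have hS : Monotone S := fun n n' h =>
    Nat.floor_le_floor (mul_le_mul_of_nonneg_left (phi_mono (by positivity) h) (Nat.cast_nonneg K))
  have hsmall : ∀ n : ℕ, ∃ C : ArithCircuit ℂ (Fin n × Fin n),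
      C.Computes (perPoly (Fin n) ℂ) ∧ C.productDepth ≤ max Δ₀ 1 ∧ C.edgeSize ≤ S n := fun n => by
    obtain ⟨C, h1, h2, h3⟩ := hK n
    exact ⟨C, h1, h2.trans (le_max_left _ _), Nat.le_floor h3⟩
  obtain ⟨b, key⟩ := exists_imm_circuits_of_per_circuits dd (fun m => min_le_left _ _) S hS hsmall
  obtain ⟨m, -, hm2, hd₀, hfl, hlt⟩ := quasi_arith b K d₀ 0 hδ₁ hδ₁1 hε₁ hε₁1
  obtain ⟨D, hDc, hDd, hDs⟩ := key m
  have hddm : dd m = ⌊ε₁ * Real.log m⌋₊ := min_eq_right hfl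
  have hlow : (m : ℝ) ^ (((dd m : ℕ) : ℝ) ^ δL) ≤ (D.size : ℝ) := by
    refine hL m (dd m) (by rw [hddm]; exact hd₀) ?_ D hDd hDc
    have h0 : 0 ≤ ε₁ * Real.log m := mul_nonneg hε₁.le (Real.log_natCast_nonneg m)
    calc ((dd m : ℕ) : ℝ) ≤ ε₁ * Real.log m := by rw [hddm]; exact Nat.floor_le h0
      _ ≤ ε * Real.log m := mul_le_mul_of_nonneg_right hε₁le (Real.log_natCast_nonneg m)
  have hexp : ((dd m : ℕ) : ℝ) ^ δ₁ ≤ ((dd m : ℕ) : ℝ) ^ δL := by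
    rcases Nat.eq_zero_or_pos (dd m) with h0 | hpos
    · rw [h0]; simp [Real.zero_rpow hδ₁.ne', Real.zero_rpow hδL.ne']
    · exact Real.rpow_le_rpow_of_exponent_le (by exact_mod_cast hpos) hδ₁le
  have hm1 : (1 : ℝ) ≤ m := by exact_mod_cast (show 1 ≤ m by omega)
  have hup : (D.size : ℝ) ≤ (K : ℝ) * ((((m ^ b + b : ℕ) : ℝ) + 2) ^
      (Real.log (((m ^ b + b : ℕ) : ℝ) + 2)) ^ (δ₁ / 2)) :=
    calc (D.size : ℝ) ≤ (S (m ^ b + b) : ℝ) := by exact_mod_cast hDs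
      _ ≤ _ := Nat.floor_le (mul_nonneg (Nat.cast_nonneg K) (Real.rpow_nonneg (by positivity) _))
  have hfinal := (Real.rpow_le_rpow_of_exponent_le hm1 hexp).trans (hlow.trans hup)
  rw [hddm] at hfinal
  exact absurd hfinal (not_le.2 hlt)

/-- **Infinitely-often form with threshold** (the `n < m₀` absorbed into `K` via their `ΣΠ`
circuits; pattern of `DefinabilityGapK1ConstDepthRung.perHard_io`).
[cite: LimayeSrinivasanTavenas2025, Cor. 4] -/
theorem perHard_io_quasi {Δ₁ : ℕ} (hΔ₁ : 1 ≤ Δ₁) :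
    ∃ δ : ℝ, 0 < δ ∧ ∀ m₀ : ℕ, ∃ n : ℕ, m₀ ≤ n ∧
      ∀ Γ : ArithCircuit ℂ (Fin n × Fin n), Γ.Computes (perPoly (Fin n) ℂ) →
        Γ.productDepth ≤ Δ₁ →
          ((n : ℝ) + 2) ^ (Real.log ((n : ℝ) + 2)) ^ δ < (Γ.edgeSize : ℝ) := by
  classical
  obtain ⟨δ, hδ, hno⟩ := perHardQuasi Δ₁
  refine ⟨δ, hδ, fun m₀ => ?_⟩
  by_contra hcon
  push Not at hcon
  have hsmall : ∀ n : ℕ, ∃ Γ : ArithCircuit ℂ (Fin n × Fin n), Γ.Computes (perPoly (Fin n) ℂ) ∧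
      Γ.productDepth ≤ Δ₁ := fun n => by
    obtain ⟨P, -, hP, hd⟩ := ArithCircuit.exists_computes_productDepth_one_holds (k := ℂ)
      (σ := Fin n × Fin n) (perPoly (Fin n) ℂ)
    exact ⟨P, hP, hd.trans hΔ₁⟩
  choose C₀ hC₀c hC₀d using hsmall
  obtain ⟨B, hB⟩ : ∃ B : ℕ, ∀ n, n < m₀ → (C₀ n).edgeSize ≤ B :=
    ⟨(Finset.range m₀).sup fun n => (C₀ n).edgeSize, fun n hn =>
      Finset.le_sup (f := fun n => (C₀ n).edgeSize) (Finset.mem_range.2 hn)⟩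
  refine hno ⟨B + 1, fun n => ?_⟩
  have hn1 : (1 : ℝ) ≤ (n : ℝ) + 2 := by norm_cast; omega
  have hΦ1 : (1 : ℝ) ≤ ((n : ℝ) + 2) ^ (Real.log ((n : ℝ) + 2)) ^ δ :=
    Real.one_le_rpow hn1 (Real.rpow_nonneg (Real.log_nonneg hn1) _)
  have hΦ0 : (0 : ℝ) ≤ ((n : ℝ) + 2) ^ (Real.log ((n : ℝ) + 2)) ^ δ := by linarith
  by_cases hn : m₀ ≤ n
  · obtain ⟨Γ, hCc, hCd, hCe⟩ := hcon n hn
    exact ⟨Γ, hCc, hCd, hCe.trans (le_mul_of_one_le_left hΦ0 (by exact_mod_cast B.succ_pos))⟩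
  · push Not at hn
    refine ⟨C₀ n, hC₀c n, hC₀d n, ?_⟩
    calc ((C₀ n).edgeSize : ℝ) ≤ B := by exact_mod_cast hB n hn
      _ ≤ ((B + 1 : ℕ) : ℝ) := by exact_mod_cast B.le_succ
      _ ≤ ((B + 1 : ℕ) : ℝ) * ((n : ℝ) + 2) ^ (Real.log ((n : ℝ) + 2)) ^ δ :=
        le_mul_of_one_le_right (by positivity) hΦ1

/-- ★ **RUNG 1¼ IN THE DOOR'S OWN CURRENCY**: there is `δ > 0` such that for infinitely many `n`
every homogeneous `ΣΠΣΠ` circuit for `per_n` has MORE than `(n+2)^{(log(n+2))^δ}` gates — a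
uniform quasi-polynomial lower bound on `homDepthFourCircuitSize (perPoly (Fin n) ℂ)`, strictly
above rung one.  VP-saturated; 0 S-currency; crux `Depth4HomFour` (slope `c·√n`) untouched.
[cite: LimayeSrinivasanTavenas2025, Cor. 4] [cite: KumarSaraf2017, §3] -/
theorem homDepthFour_perPoly_io_quasi :
    ∃ δ : ℝ, 0 < δ ∧ ∀ m₀ : ℕ, ∃ n : ℕ, m₀ ≤ n ∧ ∀ s : ℕ,
      homDepthFourCircuitSize (perPoly (Fin n) ℂ) ≤ (s : ℕ∞) →
        ((n : ℝ) + 2) ^ (Real.log ((n : ℝ) + 2)) ^ δ < (s : ℝ) := by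
  classical
  obtain ⟨δ₂, hδ₂, hio⟩ := perHard_io_quasi (Δ₁ := 2) one_le_two
  obtain ⟨δ, hδ, hδδ⟩ : ∃ δ : ℝ, 0 < δ ∧ δ + δ = δ₂ := ⟨δ₂ / 2, by positivity, by ring⟩
  refine ⟨δ, hδ, fun m₀ => ?_⟩
  obtain ⟨n, hn, hhard⟩ := hio (max (max m₀ 2) ⌈Real.exp ((6 : ℝ) ^ (1 / δ))⌉₊)
  have hn2 : 2 ≤ n := ((le_max_right _ _).trans (le_max_left _ _)).trans hn
  have hnN : ⌈Real.exp ((6 : ℝ) ^ (1 / δ))⌉₊ ≤ n := (le_max_right _ _).trans hn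
  refine ⟨n, ((le_max_left _ _).trans (le_max_left _ _)).trans hn, fun s hs => ?_⟩
  have hn0 : (0 : ℝ) ≤ n := Nat.cast_nonneg n
  have hnpos : (0 : ℝ) < (n : ℝ) + 2 := by linarith
  have hL0 : 0 < Real.log ((n : ℝ) + 2) := Real.log_pos (by linarith)
  have hL6 : (6 : ℝ) ^ (1 / δ) ≤ Real.log ((n : ℝ) + 2) := by
    rw [Real.le_log_iff_exp_le hnpos]
    calc Real.exp ((6 : ℝ) ^ (1 / δ)) ≤ ⌈Real.exp ((6 : ℝ) ^ (1 / δ))⌉₊ := Nat.le_ceil _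
      _ ≤ (n : ℝ) := by exact_mod_cast hnN
      _ ≤ (n : ℝ) + 2 := by linarith
  have hy6 : (6 : ℝ) ≤ (Real.log ((n : ℝ) + 2)) ^ δ := by
    calc (6 : ℝ) = ((6 : ℝ) ^ (1 / δ)) ^ δ := by
          rw [← Real.rpow_mul (by norm_num : (0 : ℝ) ≤ 6), one_div_mul_cancel hδ.ne',
            Real.rpow_one]
      _ ≤ (Real.log ((n : ℝ) + 2)) ^ δ := Real.rpow_le_rpow (by positivity) hL6 hδ.le
  have hy0 : 0 ≤ (Real.log ((n : ℝ) + 2)) ^ δ := by linarith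
  obtain ⟨P, hPc, hP4, hPh, hPs⟩ :=
    Depth4HomFourRung.exists_circuit_of_homDepthFourCircuitSize_le hs
  have hper : (perPoly (Fin n) ℂ).IsHomogeneous n := by
    have h' := perPoly_isHomogeneous (n := Fin n) (k := ℂ)
    rwa [Fintype.card_fin] at h'
  obtain ⟨C, hCc, hCd, hCe⟩ :=
    Depth4HomFourRung.exists_productDepth_two_of_homDepthFour hPc hP4 hPh hper hn2
  simp only [Fintype.card_prod, Fintype.card_fin] at hCe
  by_contra hcon
  rw [not_lt] at hcon
  have hY1 : (1 : ℝ) ≤ ((n : ℝ) + 2) ^ (Real.log ((n : ℝ) + 2)) ^ δ :=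
    Real.one_le_rpow (by linarith) hy0
  have hE : (C.edgeSize : ℝ) ≤ (((s : ℝ) + (n : ℝ) * n + 1) * ((n : ℝ) + 2)) ^ 3 := by
    have h1 : C.edgeSize ≤ ((s + n * n + 1) * (n + 2)) ^ 3 := hCe.trans
      (Nat.pow_le_pow_left (Nat.mul_le_mul_right _ (by simpa using hPs)) 3)
    exact_mod_cast h1
  have hsq1 : (1 : ℝ) ≤ ((n : ℝ) + 2) ^ 2 := by nlinarith
  have hbase : (s : ℝ) + (n : ℝ) * n + 1 ≤
      2 * ((n : ℝ) + 2) ^ (Real.log ((n : ℝ) + 2)) ^ δ * ((n : ℝ) + 2) ^ 2 := by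
    have h1 : (s : ℝ) ≤ ((n : ℝ) + 2) ^ (Real.log ((n : ℝ) + 2)) ^ δ * ((n : ℝ) + 2) ^ 2 :=
      hcon.trans (le_mul_of_one_le_right (by positivity) hsq1)
    have h2 : (n : ℝ) * n + 1 ≤ ((n : ℝ) + 2) ^ (Real.log ((n : ℝ) + 2)) ^ δ * ((n : ℝ) + 2) ^ 2 :=
      le_trans (by nlinarith) (le_mul_of_one_le_left (by positivity) hY1)
    linarith
  have hU : (((s : ℝ) + (n : ℝ) * n + 1) * ((n : ℝ) + 2)) ^ 3 ≤
      (2 * ((n : ℝ) + 2) ^ (Real.log ((n : ℝ) + 2)) ^ δ * ((n : ℝ) + 2) ^ 2 * ((n : ℝ) + 2)) ^ 3 :=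
    pow_le_pow_left₀ (by positivity) (mul_le_mul_of_nonneg_right hbase hnpos.le) 3
  have hlog8 : Real.log 8 ≤ 3 * Real.log ((n : ℝ) + 2) := by
    rw [show (8 : ℝ) = 2 ^ 3 by norm_num, Real.log_pow, Nat.cast_ofNat]
    exact mul_le_mul_of_nonneg_left (Real.log_le_log (by norm_num) (by linarith)) (by norm_num)
  have hlogU : Real.log ((2 * ((n : ℝ) + 2) ^ (Real.log ((n : ℝ) + 2)) ^ δ *
      ((n : ℝ) + 2) ^ 2 * ((n : ℝ) + 2)) ^ 3) ≤
        ((Real.log ((n : ℝ) + 2)) ^ δ * (Real.log ((n : ℝ) + 2)) ^ δ) *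
          Real.log ((n : ℝ) + 2) := by
    rw [show (2 * ((n : ℝ) + 2) ^ (Real.log ((n : ℝ) + 2)) ^ δ * ((n : ℝ) + 2) ^ 2 *
        ((n : ℝ) + 2)) ^ 3 = 8 * ((((n : ℝ) + 2) ^ (Real.log ((n : ℝ) + 2)) ^ δ) ^ 3 *
          ((n : ℝ) + 2) ^ 9) by ring]
    rw [Real.log_mul (by norm_num) (by positivity), Real.log_mul (by positivity) (by positivity),
      Real.log_pow, Real.log_pow, Real.log_rpow hnpos]
    push_cast
    nlinarith [mul_le_mul_of_nonneg_right hy6 (mul_nonneg hy0 hL0.le),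
      mul_le_mul_of_nonneg_right hy6 hL0.le, hlog8, hL0]
  have hfin : (((s : ℝ) + (n : ℝ) * n + 1) * ((n : ℝ) + 2)) ^ 3 ≤
      ((n : ℝ) + 2) ^ (Real.log ((n : ℝ) + 2)) ^ δ₂ := by
    refine hU.trans ?_
    rw [Real.le_rpow_iff_log_le (by positivity) hnpos, ← hδδ, Real.rpow_add hL0]
    exact hlogU
  exact absurd ((hhard C hCc hCd).trans_le (hE.trans hfin)) (lt_irrefl _)

end Summit.ValiantsHypothesis.ValiantsHypothesis.Theorems.Depth4HomFourQuasi

end
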